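import Summits.QuantumFields.BalabanUV.Beta.D1BFx.KGhostLeg
import Summits.QuantumFields.BalabanUV.Beta.D1BFx.TorusWeightJetsCombFree
import Summits.QuantumFields.BalabanUV.Beta.D1BFx.TorusGaugeBasisKernel

/-!
# `BalabanUV.Beta.D1BFx.KGhostLegJunction` — road «BF-x» for binder row D1, slot (K), brick **TB5-2c-B, PART 2: THE JUNCTION `Ĉ = (Cgh)^`** (ruling ρ-g7-1 (1)):
# on every coarse torus, for a basis `N` of `ker Ŝ` (in particular `N := N̂ = TorusGaugeBasisMatrix.Nhat`), leaf-03-g9's comb-free site leg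
# `TorusWeightJetsCombFree.Chat ((m+1)·p) N = N·(NᵀL̂L̂N)⁻¹·Nᵀ` IS the fibred periodisation of PART 1's `ℤ⁴` kernel `Cgh (m+1) a = (m+1)⁴·(Ggh ∘ Rgt ∘ Ggh)` re-indexed along
# `ι x = (x, ())` — `Chat_eq` (`= (m+1)⁴•Ĝ′(1 − P̂)Ĝ′`, p243697) ∘ `KGhostLeg.submatrix_unit_periodiseF_toF_Cgh`.  Hence (§2) the two scalar functionals of TB5-2c-A
# `KGhostTerm.hessT_ghostTerm_Nhat` ∕ A′ `KGhostTermWords.hessT_ghostTerm_words` are `hessT ((Cgh)^; words^)` (`KGhostLeg.hessT_submatrix_unit`) — the dictionary letter `hC`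
# of TB5-3 `KCombine.identity_array_currency`

HONEST FRAMING (cell contract, verbatim): «discharging `BetaPertH` makes Bałaban's UV stability UNCONDITIONAL — a real constructive-QFT
result; it is NOT the continuum limit and NOT the Clay problem.»  HONEST DEPENDENCY (verbatim): «continuum YM on T⁴ ⇐ BetaPertH ∧ nine
spine estimates (0/9 proved); BetaPertH ⇐ (D1) ∧ (D4) ∧ CAP+tail; G-an2-4 gates asym, D1 and NE2/3/4.»  THIS MODULE DISCHARGES NOTHING of
D1 / BetaPertH: [folklore] two rewrites BY NAME (leaf-03-g9 `Chat_eq`, this lineage's `KGhostLeg`, ne9-leaf-09-g38 `TorusGaugeBasisKernel`).  No `def`,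
no `def … : Prop`, nothing cited, 0 sorry.  NOT summit progress; NOT BetaPertH, NOT continuum, NOT Clay.

ABSOLUTE RULE (cell, verbatim): «No internally-minted statement may enter as a cited fact. Every hypothesis is either kernel-proved in this
package or a verbatim quotation of a PUBLISHED theorem with page reference. The manuscript(s) under audit are NOT citable for their own
disputed steps — they are the thing under adjudication; programme-internal (2001/route/tribunal) claims are never citable.»

CONTENT (all [folklore]).
* §1 `Chat_eq_submatrix_periodiseF_Cgh` (any basis `N` of `ker Ŝ`), **`Chat_Nhat_eq_submatrix_periodiseF_Cgh`** (at `N̂`).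
* §2 **`hessT_Chat_Nhat_eq`**: `hessT (Chat s N̂) (X.submatrix ι ι) (X′.submatrix ι ι) (Y.submatrix ι ι) = hessT ((Cgh (m+1) a)^) X X′ Y` for fibred `X X′ Y`.
Unit `b2b-balaban-beta-d1-p2` (road owner, gen 7).
-/

noncomputable section

namespace Summit.QuantumFields.BalabanUV.Beta.D1BFx.KGhostLegJunction

open Matrix
open scoped BigOperators
open Literature.MathematicalPhysics.QuantumFieldTheory.Balaban1983to89
open Literature.MathematicalPhysics.QuantumFieldTheory.Balaban1983to89.Beta
open AffineAveraging (box toSite)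
open Summit.QuantumFields.BalabanUV.Beta.D1BFx.FibredPeriodisation (periodiseF)
open Summit.QuantumFields.BalabanUV.Beta.D1BFx.PeriodicArrays (toF)
open Summit.QuantumFields.BalabanUV.Beta.D1BFx.MixedVarPackedHess (hessT)
open Summit.QuantumFields.BalabanUV.Beta.D1BFx.PeriodisedProjector (Shat)
open Summit.QuantumFields.BalabanUV.Beta.D1BFx.TorusGaugeBasisMatrix (Nhat)
open Summit.QuantumFields.BalabanUV.Beta.D1BFx.TorusGaugeBasisKernel (Nhat_range Nhat_injective)
open Summit.QuantumFields.BalabanUV.Beta.D1BFx.TorusWeightJetsCombFree (Chat Chat_eq)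
open Summit.QuantumFields.BalabanUV.Beta.D1BFx.KGhostLeg (Cgh submatrix_unit_periodiseF_toF_Cgh hessT_submatrix_unit)

variable (m : ℕ) {a : ℝ} (p : ℕ) [NeZero p]

/-! ## §1 The junction -/

/-- [folklore] **`Ĉ = (Cgh)^` RE-INDEXED**, for ANY basis `N` of `ker Ŝ`: `Chat ((m+1)·p) N = (of (periodiseF ((m+1)·p) (toF (Cgh (m+1) a)))).submatrix ι ι`. -/
theorem Chat_eq_submatrix_periodiseF_Cgh (ha : 0 < a) {ρ : Type*} [Fintype ρ] [DecidableEq ρ] {N : Matrix (Site 4 ((m + 1) * p)) ρ ℝ}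
    (hN : ∀ lam : Site 4 ((m + 1) * p) → ℝ, Shat m ((m + 1) * p) *ᵥ lam = 0 ↔ ∃ c : ρ → ℝ, lam = N *ᵥ c)
    (hNinj : Function.Injective N.mulVec) :
    Chat ((m + 1) * p) N
      = (Matrix.of (periodiseF ((m + 1) * p) (toF (Cgh (m + 1) a)))).submatrix (fun x => (x, ())) (fun y => (y, ())) := by
  rw [Chat_eq m p ha hN hNinj, ← submatrix_unit_periodiseF_toF_Cgh (m + 1) a ha (Dvd.intro p rfl)]
  simp only [Nat.add_sub_cancel, Nat.cast_add, Nat.cast_one]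

/-- [folklore] **`Ĉ = (Cgh)^` AT THE CANONICAL COMB BASIS `N̂`** (basis facts from «K-TB3b-N» `TorusGaugeBasisKernel`): for `r ∈ box 4 (m+1)`,
`Chat ((m+1)·p) N̂ = ((Cgh (m+1) a)^).submatrix ι ι` — the dictionary letter `hC` of `KCombine.identity_array_currency`. -/
theorem Chat_Nhat_eq_submatrix_periodiseF_Cgh (ha : 0 < a) {r : Fin 4 → ℕ} (hr : r ∈ box 4 (m + 1)) :
    Chat ((m + 1) * p) (Nhat r (m + 1) p)
      = (Matrix.of (periodiseF ((m + 1) * p) (toF (Cgh (m + 1) a)))).submatrix (fun x => (x, ())) (fun y => (y, ())) :=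
  Chat_eq_submatrix_periodiseF_Cgh m p ha (Nhat_range r m p hr) (Nhat_injective r (m + 1) p hr)

/-! ## §2 The two scalar functionals of TB5-2c-A are `hessT ((Cgh)^; ·)` -/

/-- [folklore] **THE GHOST FUNCTIONALS IN FIBRED CURRENCY**: for fibred site words `X X′ Y` on `Site 4 ((m+1)p) × Unit`,
`hessT (Chat s N̂) (X.submatrix ι ι) (X′.submatrix ι ι) (Y.submatrix ι ι) = hessT ((Cgh (m+1) a)^) X X′ Y` — so once «TB4-W» 3b writes the site words of
`KGhostTerm(Words)` as `(arr …)^.submatrix ι ι`, both ghost-side functionals are in the shape of `KGhostLeg.tendsto_hessT_Cgh`. -/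
theorem hessT_Chat_Nhat_eq (ha : 0 < a) {r : Fin 4 → ℕ} (hr : r ∈ box 4 (m + 1))
    (X X' Y : Matrix (Site 4 ((m + 1) * p) × Unit) (Site 4 ((m + 1) * p) × Unit) ℝ) :
    hessT (Chat ((m + 1) * p) (Nhat r (m + 1) p)) (X.submatrix (fun x => (x, ())) (fun y => (y, ())))
        (X'.submatrix (fun x => (x, ())) (fun y => (y, ()))) (Y.submatrix (fun x => (x, ())) (fun y => (y, ())))
      = hessT (Matrix.of (periodiseF ((m + 1) * p) (toF (Cgh (m + 1) a)))) X X' Y := by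
  rw [Chat_Nhat_eq_submatrix_periodiseF_Cgh m p ha hr, hessT_submatrix_unit]

end Summit.QuantumFields.BalabanUV.Beta.D1BFx.KGhostLegJunction

end
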